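import Summits.QuantumFields.YangMills.Theorems.F4SubCurvatureDoorLaplaceFourierRegistered
import Mathlib
import HarnessLib

/-!
# LINE g21-A «SHELL SEPARATION» — FIRST RUNGS BY NAME (defs only; `--supports stmt-QuantumFields-23125` targets)
# crux ⟨stmt-QuantumFields-23125⟩ `F4SubCurvatureDoor.RationalToGeneral`; skeleton `Lines/shell_separation.lean` (71dee36d4744)

Seat `ym-idea-3` g21.  Like `ShortRootRigidity/Lines/angular_type_rungs.lean`: this file registers NO stubs and changes NO registry entry; it
names four PROVABLE rungs of the line so that free hands can land them BY NAME (`theorem <name>_holds : <Name>` in a `Theorems/` file restating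
the Prop character-identically, `--supports stmt-QuantumFields-23125 --as helper`).  Order of value: R-S2c (pure measure theory, Mathlib only,
the heart of the lever) → R-S3fin (the BC5-type WITNESS RUNG of the wall stub S3 outside the proved rational regime of ⟨23124⟩) → R-S2a → R-S3fin⁺.

* R-S2c `OneSidedDeterminacy` (M, Mathlib only): two finite positive measures on `[0, ∞)` with an exponential-square-root moment
  `∫ e^{c√q} < ∞` and equal power moments are equal.  (Push forward to `λ = √q`; the even extensions to `ℝ` have `∫ e^{c|λ|} < ∞`, hence
  `ProbabilityTheory.complexMGF` analytic on the strip `|Re z| < c`; the even moments are the Taylor coefficients at `0`, the odd ones vanish;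
  identity theorem; uniqueness of measures with equal `complexMGF` on a strip; pull back.)  This is step (3) of `stub_shellSeparation` (applied
  to the Jordan parts `τ¹⁺ + τ²⁻`, `τ²⁺ + τ¹⁻`).  [Akhiezer1965 Ch. 2 §5; Schmudgen2020 Lect. 4 (Carleman, Stieltjes case)]
* R-S2a `LaplacianMultiplier` (M): under forward-cone support, the Laplacian of a class kernel at `(t, z⃗)`, `t > 0`, is the Laplace–Fourier
  integral with the extra factor `q = E² − |q⃗|²` (differentiation under the integral sign, `hasDerivAt_integral_of_dominated_loc_of_deriv_le`;
  the moments exist because `|q⃗| ≤ E` a.e. and `E² e^{−tE} ≤ C_t e^{−tE/2}`).  Step (2) of `stub_shellSeparation` for `k = 1` (iterate for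
  general `k`).  [GlimmJaffeQP1987 §6.2; folklore]
* R-S3fin `FiniteShellFiniteType` (M–L; THE WITNESS RUNG of S3): a class kernel whose forward-cone Laplace–Fourier measure is carried by FINITELY
  MANY mass shells `{q ∈ s}` has finite harmonic type.  Mechanism (no moment problem needed): the Helmholtz projectors `Π_{m'≠m}(Δ − m'²)/(m² − m'²)`
  split `K = Σ_m K_m` into `W(F₄)`-invariant real-analytic solutions of `(Δ − m²)K_m = 0` on `ℝ⁴ ∖ 0`, bounded at `∞`, `O(r^{−8−2(|s|−1)})` at `0`;
  the spherical-harmonic coefficients of such a solution solve the radial equation `g'' + (3/r)g' − (L(L+2)/r² + m²)g = 0`, whose solutions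
  bounded at `∞` blow up like `r^{−L−2}` at `0` (regular singular point, indicial roots `L`, `−L−2`) unless zero — so only `L < 8 + 2|s| − 2`
  survive: finitely many channels.  It lies OUTSIDE the proved regime of ⟨23124⟩ `RationalShortRootRigidity` (rational kernels = massless finite
  type) as soon as one `m > 0`.  [Widder1941 Ch. VI (uniqueness of LF measures); AxlerBourdonRamey2001 Ch. 5/10 (harmonic expansions); folklore ODE]
* R-S3fin⁺ `FiniteShellRigidity` (M given R-S3fin and the line's T2′ block): the same kernels are RADIAL — R-S3fin feeds `FiniteTypeRigidity`
  (skeleton: Fischer ✓ + LF ✓ + `ChannelShellForm` (stub) + NCP ✓ + CFE ✓); in the finite-shell case `ChannelShellForm`'s content is explicit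
  (the shell densities ARE the harmonic symbols `H_L(E, i q⃗)` on the hyperboloids, Vandermonde moment conditions `Σ_i a_{L,i} m_i^{2k−L−1} = 0`
  for `0 ≤ 2k ≤ L − 6`, so every layer `L ≥ 2|s| + 4` is absent and the layered alternation A′ descends from the top layer by cone–Fatou).
HONEST LABEL: rungs of an OPEN line; nothing of C3, ⟨23125⟩, ⟨23035⟩, R2d or YM is proved here; no summit is proved by a line.
-/

set_option autoImplicit false

noncomputable section

namespace Summit.QuantumFields.YangMills.Cruxes.RationalToGeneral.ShellSeparationRungs

open scoped Topology BigOperators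
open Filter Set MeasureTheory
open Summit.QuantumFields.YangMills.Theorems.F4SubCurvatureDoorLaplaceFourierRegistered (E4 E3 InClass timeSpace IsLF)

/-- R-S2c «ONE-SIDED DETERMINACY» (M, Mathlib only): finite positive measures on `[0,∞)` with an `e^{c√q}`-moment and equal power moments
coincide. [problem-side rung; Akhiezer1965 Ch. 2 §5, Schmudgen2020 Lect. 4] -/
def OneSidedDeterminacy : Prop :=
  ∀ (σ τ : Measure ℝ) (c : ℝ), 0 < c → IsFiniteMeasure σ → IsFiniteMeasure τ →
    σ (Set.Iio 0) = 0 → τ (Set.Iio 0) = 0 →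
    Integrable (fun q : ℝ => Real.exp (c * Real.sqrt q)) σ →
    Integrable (fun q : ℝ => Real.exp (c * Real.sqrt q)) τ →
    (∀ k : ℕ, ∫ q, q ^ k ∂σ = ∫ q, q ^ k ∂τ) → σ = τ

/-- R-S2a «LAPLACIAN MULTIPLIER» (M): under forward-cone support the Laplacian of a class kernel at `(t, z⃗)`, `t > 0` — written as the sum of
the four second directional derivatives `D²K(x)(eᵢ, eᵢ)` — is the Laplace–Fourier integral weighted by the mass squared `E² − |q⃗|²`.
[problem-side rung; GlimmJaffeQP1987 §6.2, folklore] -/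
def LaplacianMultiplier : Prop :=
  ∀ K : E4 → ℝ, InClass K → ∀ μ : Measure (ℝ × E3), IsLF K μ → μ {p | p.1 < ‖p.2‖} = 0 →
    ∀ (t : ℝ) (z : E3), 0 < t →
      Integrable (fun p : ℝ × E3 => (p.1 ^ 2 - ‖p.2‖ ^ 2) * Real.exp (-(t * p.1))) μ ∧
      (∑ i : Fin 4, iteratedFDeriv ℝ 2 K (timeSpace t z) (fun _ => EuclideanSpace.single i (1 : ℝ)))
        = ∫ p : ℝ × E3, (p.1 ^ 2 - ‖p.2‖ ^ 2) * Real.exp (-(t * p.1)) * Real.cos (inner ℝ p.2 z) ∂μ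

/-- R-S3fin «FINITE-SHELL FINITE TYPE» (M–L; the witness rung of the wall stub S3, outside the rational regime of ⟨23124⟩): a class kernel whose
forward-cone Laplace–Fourier measure is carried by finitely many mass shells `{E² − |q⃗|² ∈ s}` has finitely many harmonic channels
(Helmholtz projectors + radial indicial roots `L`, `−L−2` + the budget). [problem-side rung; Widder1941 Ch. VI; AxlerBourdonRamey2001 Ch. 5] -/
def FiniteShellFiniteType : Prop :=
  ∀ K : E4 → ℝ, InClass K → ∀ μ : Measure (ℝ × E3), IsLF K μ → μ {p | p.1 < ‖p.2‖} = 0 →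
    ∀ s : Finset ℝ, μ {p | p.1 ^ 2 - ‖p.2‖ ^ 2 ∉ (↑s : Set ℝ)} = 0 →
      ∃ (N : ℕ) (P : Fin N → MvPolynomial (Fin 4) ℝ) (g : Fin N → ℝ → ℝ),
        ∀ x : E4, x ≠ 0 → K x = ∑ j, g j (‖x‖ ^ 2) * MvPolynomial.eval (fun i => x i) (P j)

/-- R-S3fin⁺ «FINITE-SHELL RIGIDITY» (M given R-S3fin + the line's T2′ block): the same kernels are radial off `0`. [problem-side rung] -/
def FiniteShellRigidity : Prop :=
  ∀ K : E4 → ℝ, InClass K → ∀ μ : Measure (ℝ × E3), IsLF K μ → μ {p | p.1 < ‖p.2‖} = 0 →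
    ∀ s : Finset ℝ, μ {p | p.1 ^ 2 - ‖p.2‖ ^ 2 ∉ (↑s : Set ℝ)} = 0 →
      ∃ g₀ : ℝ → ℝ, ∀ x : E4, x ≠ 0 → K x = g₀ (‖x‖ ^ 2)

end Summit.QuantumFields.YangMills.Cruxes.RationalToGeneral.ShellSeparationRungs

end
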